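import Literature.Geometry.Lorentzian.CoordWeyl
import HarnessLib

/-!
# The differential Bianchi identity for the Weyl tensor of Einstein components, and `δW⁺ = 0`

Continuation of `CoordWeyl.lean` (namespace `MetricCoord`: components `G` of a pseudo-Riemannian
metric, smooth, symmetric and nondegenerate on an open set `V`; Weyl endomorphism `weylAt`, its
covariant derivative along constant fields `covWeylAt`, and for EINSTEIN components `Ric = λ G` on
`V` (`m = dim E ≥ 3`): `∇W = ∇R` (`covWeylAt_eq_covRiemAt_of_einstein`) and harmonicity
`Σᵢ bⁱ((∇_{bᵢ}W)(X,Y)Z) = 0` (`sum_coord_covWeylAt_eq_zero_of_einstein`)). Everything here is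
PROVED; no definition, no statement of `Prop` type.

For Einstein components the Weyl tensor inherits ALL differential symmetries of `R`:

* `IsMetricOn.covWeylAt_cyclic_of_einstein` — **the second Bianchi identity for `W`**:
  `(∇_{W₀} W)(X,Y) + (∇_X W)(Y,W₀) + (∇_Y W)(W₀,X) = 0` (from `covRiemAt_cyclic`; in general
  `d^∇W = −d^∇(P ⊙ g)` is the Cotton tensor, which vanishes when the Schouten tensor `P` is parallel —
  Besse 1987, 16.3–16.5);
* `IsMetricOn.apply_covWeylAt_swap_of_einstein`, `…_swap₁₂_…`, `…_pair_comm_…`,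
  `IsMetricOn.covWeylAt_cyclic₂_of_einstein` — skew-symmetry in both pairs, pair symmetry and the
  differentiated first Bianchi identity of `G((∇_{W₀}W)(X,Y)Z, U)`;
* `IsMetricOn.sum_apply_covWeylAt_eq_zero_of_einstein` —
  in a `G_x`-ORTHONORMAL basis `b` (`G(bᵢ,bⱼ) = δᵢⱼ`) the dual basis is `bⁱ = G(bᵢ,·)`, so
  harmonicity reads `Σᵢ G(bᵢ, (∇_{bᵢ}W)(X,Y)Z) = 0`, i.e. `Σᵢ (∇ᵢW)_{XYZi} = 0` for the frame
  components `(∇_mW)_{ijkl} = G((∇_{b_m}W)(bᵢ,bⱼ)b_k, b_l)`; with pair symmetry equivalently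
  `Σᵢ (∇ᵢW)_{iYZU} = 0` (`sum_apply_covWeylAt_first_eq_zero_of_einstein`).

**`δW⁺ = 0` (Gursky–LeBrun 1999, §3, (div): "`∇^a W⁺_{abcd} = 0`").** In dimension four and an
oriented orthonormal frame, `W⁺_{ijkl} = ½(W_{ijkl} + ½ε_{ijab}W_{abkl})` (the Weyl tensor
commutes with `⋆`), so `2(δW⁺)_{jkl} = Σ_m (∇_mW)_{mjkl} + ½ Σ_{m,a,b} ε_{mjab}(∇_mW)_{abkl}`: the
first sum vanishes by harmonicity (`sum_apply_covWeylAt_first_eq_zero_of_einstein`) and the second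
is, for each `j`, `±2` times the cyclic sum of `(∇W)_{··kl}` over the three indices complementary
to `j`, which vanishes by the second Bianchi identity for `W`
(`apply_covWeylAt_cyclic_of_einstein`; e.g. `j = 0`:
`(∇₁W)_{23kl} + (∇₂W)_{31kl} + (∇₃W)_{12kl} = 0`, `star_divergence_weylAt_eq_zero_of_einstein`).
Hence both chiral halves of an Einstein metric's Weyl tensor are divergence-free — the two facts
are recorded here frame-free, without introducing `ε` or `W⁺` as definitions.

## References

* A. L. Besse, *Einstein manifolds*, Springer 1987, 16.3–16.5, 16.24 (i) (`Dr = 0 ⟹ δR = 0`,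
  `δW = 0`, `d^∇W = 0`). [Besse1987]
* B. O'Neill, *Semi-Riemannian geometry*, Academic Press 1983, Ch. 3, Prop. 3.36–3.37. [ONeill1983]
* M. J. Gursky, C. LeBrun, Ann. Global Anal. Geom. 17 (1999) 315–328 (arXiv:math/9807055), §3,
  (div). [GurskyLebrun1999]
-/

noncomputable section

set_option maxSynthPendingDepth 3

open Set Filter ContinuousLinearMap Module
open scoped Topology ContDiff

namespace Literature.Geometry.Lorentzian

namespace MetricCoord

variable {E : Type*} [NormedAddCommGroup E] [NormedSpace ℝ E] [FiniteDimensional ℝ E]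
  [CompleteSpace E] {G : E → E →L[ℝ] E →L[ℝ] ℝ} {V : Set E} {x : E}

/-! ### The differential symmetries of `∇W` for Einstein components -/

section Einstein

variable (hG : IsMetricOn G V) (hx : x ∈ V) (hm : 3 ≤ Module.finrank ℝ E) {lam : ℝ}
  (hE : ∀ y ∈ V, ricAt G y = lam • G y)

include hG hx hm hE

/-- **The second Bianchi identity for the Weyl tensor of Einstein components**:
`(∇_{W₀} W)(X,Y) + (∇_X W)(Y,W₀) + (∇_Y W)(W₀,X) = 0` — `∇W = ∇R` for Einstein components
(`covWeylAt_eq_covRiemAt_of_einstein`) and the second Bianchi identity `covRiemAt_cyclic`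
(O'Neill 1983, Ch. 3, Prop. 3.37; Besse 1987, 16.3: `d^∇W = 0` when the Schouten tensor is parallel).
[cite: Besse1987, 16.3–16.5] [cite: ONeill1983, Ch. 3, Prop. 3.37] -/
theorem IsMetricOn.covWeylAt_cyclic_of_einstein (W₀ X Y : E) :
    covWeylAt G x W₀ X Y + covWeylAt G x X Y W₀ + covWeylAt G x Y W₀ X = 0 := by
  rw [hG.covWeylAt_eq_covRiemAt_of_einstein hx hm hE, hG.covWeylAt_eq_covRiemAt_of_einstein hx hm hE,
    hG.covWeylAt_eq_covRiemAt_of_einstein hx hm hE]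
  exact hG.covRiemAt_cyclic hx W₀ X Y

/-- The second Bianchi identity for `W`, lowered: `G((∇_{W₀}W)(X,Y)Z,U) + G((∇_XW)(Y,W₀)Z,U) +
G((∇_YW)(W₀,X)Z,U) = 0`. [cite: Besse1987, 16.3–16.5] -/
theorem IsMetricOn.apply_covWeylAt_cyclic_of_einstein (W₀ X Y Z U : E) :
    G x (covWeylAt G x W₀ X Y Z) U + G x (covWeylAt G x X Y W₀ Z) U +
      G x (covWeylAt G x Y W₀ X Z) U = 0 := by
  rw [← _root_.add_apply, ← _root_.add_apply, ← map_add, ← map_add, ← _root_.add_apply,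
    ← _root_.add_apply, hG.covWeylAt_cyclic_of_einstein hx hm hE, _root_.zero_apply,
    map_zero, _root_.zero_apply]

/-- `G((∇_{W₀}W)(X,Y)Z, U)` is skew in `Z, U` (Einstein components).
[cite: ONeill1983, Ch. 3, Prop. 3.36 (2)] -/
theorem IsMetricOn.apply_covWeylAt_swap_of_einstein (W₀ X Y Z U : E) :
    G x (covWeylAt G x W₀ X Y U) Z = -G x (covWeylAt G x W₀ X Y Z) U := by
  rw [hG.covWeylAt_eq_covRiemAt_of_einstein hx hm hE]
  exact hG.apply_covRiemAt_swap hx W₀ X Y Z U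

/-- `(∇_{W₀}W)(Y,X) = −(∇_{W₀}W)(X,Y)`, lowered (Einstein components).
[cite: ONeill1983, Ch. 3, Prop. 3.36 (1)] -/
theorem IsMetricOn.apply_covWeylAt_swap₁₂_of_einstein (W₀ X Y Z U : E) :
    G x (covWeylAt G x W₀ Y X Z) U = -G x (covWeylAt G x W₀ X Y Z) U := by
  rw [hG.covWeylAt_eq_covRiemAt_of_einstein hx hm hE, hG.covWeylAt_eq_covRiemAt_of_einstein hx hm hE]
  exact apply_covRiemAt_swap₁₂ W₀ X Y Z U

/-- The differentiated first Bianchi identity for `W` (Einstein components):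
`(∇_{W₀}W)(X,Y)Z + (∇_{W₀}W)(Y,Z)X + (∇_{W₀}W)(Z,X)Y = 0`. [cite: ONeill1983, Ch. 3, Prop. 3.36 (3)] -/
theorem IsMetricOn.covWeylAt_cyclic₂_of_einstein (W₀ X Y Z : E) :
    covWeylAt G x W₀ X Y Z + covWeylAt G x W₀ Y Z X + covWeylAt G x W₀ Z X Y = 0 := by
  rw [hG.covWeylAt_eq_covRiemAt_of_einstein hx hm hE, hG.covWeylAt_eq_covRiemAt_of_einstein hx hm hE,
    hG.covWeylAt_eq_covRiemAt_of_einstein hx hm hE]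
  exact hG.covRiemAt_cyclic₂ hx W₀ X Y Z

/-- **Pair symmetry of `∇W`** (Einstein components): `G((∇_{W₀}W)(X,Y)Z, U) = G((∇_{W₀}W)(Z,U)X, Y)`.
[cite: ONeill1983, Ch. 3, Prop. 3.36 (4)] -/
theorem IsMetricOn.apply_covWeylAt_pair_comm_of_einstein (W₀ X Y Z U : E) :
    G x (covWeylAt G x W₀ X Y Z) U = G x (covWeylAt G x W₀ Z U X) Y := by
  rw [hG.covWeylAt_eq_covRiemAt_of_einstein hx hm hE, hG.covWeylAt_eq_covRiemAt_of_einstein hx hm hE]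
  exact hG.apply_covRiemAt_pair_comm hx W₀ X Y Z U

end Einstein

/-! ### Harmonicity in an orthonormal basis: `Σᵢ (∇ᵢW)_{iYZU} = 0` -/

section Orthonormal

variable {ι : Type*} [Fintype ι] [DecidableEq ι]

omit [FiniteDimensional ℝ E] [CompleteSpace E] [Fintype ι] in
/-- In a `G_x`-orthonormal basis (`G(bᵢ,bⱼ) = δᵢⱼ`) the dual basis is index lowering:
`bⁱ(v) = G(bᵢ, v)` — a private variant (argument order `G(bᵢ, v)`) of
`MetricCoord.coord_eq_apply_of_orthonormal` of `CoordCurvatureNormSq.lean` (not imported here).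
[folklore] -/
private theorem coord_eq_apply_of_orthonormal' (b : Basis ι ℝ E)
    (hb : ∀ i j, G x (b i) (b j) = if i = j then 1 else 0) (i : ι) (v : E) :
    b.coord i v = G x (b i) v := by
  have h : (b.coord i : E →ₗ[ℝ] ℝ) = ((G x (b i) : E →L[ℝ] ℝ) : E →ₗ[ℝ] ℝ) := by
    refine b.ext fun j ↦ ?_
    rw [Basis.coord_apply, b.repr_self, ContinuousLinearMap.coe_coe, hb i j, Finsupp.single_apply]
    by_cases hij : i = j
    · subst hij; simp
    · simp [hij, Ne.symm hij]
  exact LinearMap.congr_fun h v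

variable (hG : IsMetricOn G V) (hx : x ∈ V) (hm : 3 ≤ Module.finrank ℝ E) {lam : ℝ}
  (hE : ∀ y ∈ V, ricAt G y = lam • G y)

include hG hx hm hE

/-- **Harmonicity of `W` in an orthonormal basis** (Einstein components): `Σᵢ G(bᵢ, (∇_{bᵢ}W)(X,Y)Z) = 0`,
i.e. `Σᵢ (∇ᵢW)_{XYZi} = 0` for the frame components `(∇_mW)_{ijkl} = G((∇_{b_m}W)(bᵢ,bⱼ)b_k, b_l)`
(`sum_coord_covWeylAt_eq_zero_of_einstein` with `bⁱ = G(bᵢ,·)`). [cite: Besse1987, 16.5]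
[cite: GurskyLebrun1999, §3, (div)] -/
theorem IsMetricOn.sum_apply_covWeylAt_eq_zero_of_einstein (b : Basis ι ℝ E)
    (hb : ∀ i j, G x (b i) (b j) = if i = j then 1 else 0) (X Y Z : E) :
    ∑ i, G x (b i) (covWeylAt G x (b i) X Y Z) = 0 := by
  have h := hG.sum_coord_covWeylAt_eq_zero_of_einstein b hx hm hE X Y Z
  simp only [coord_eq_apply_of_orthonormal' b hb] at h
  exact h

/-- Harmonicity contracted with the FIRST slot: `Σᵢ G((∇_{bᵢ}W)(bᵢ,Y)Z, U) = 0`, i.e.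
`Σᵢ (∇ᵢW)_{iYZU} = 0` (pair symmetry and symmetry of `G`). [cite: Besse1987, 16.5] -/
theorem IsMetricOn.sum_apply_covWeylAt_first_eq_zero_of_einstein (b : Basis ι ℝ E)
    (hb : ∀ i j, G x (b i) (b j) = if i = j then 1 else 0) (Y Z U : E) :
    ∑ i, G x (covWeylAt G x (b i) (b i) Y Z) U = 0 := by
  have h := hG.sum_apply_covWeylAt_eq_zero_of_einstein hx hm hE b hb Z U Y
  have h' : ∑ i, G x (covWeylAt G x (b i) (b i) Y Z) U =
      -∑ i, G x (b i) (covWeylAt G x (b i) Z U Y) := by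
    rw [← Finset.sum_neg_distrib]
    refine Finset.sum_congr rfl fun i _ ↦ ?_
    rw [hG.apply_covWeylAt_pair_comm_of_einstein hx hm hE (b i) (b i) Y Z U,
      hG.apply_covWeylAt_swap_of_einstein hx hm hE (b i) Z U Y (b i),
      hG.symm x hx (covWeylAt G x (b i) Z U Y) (b i)]
  rw [h', h, neg_zero]

/-- **The `⋆`-part of `δW⁺ = 0`**: for Einstein components and any three vectors `b₁, b₂, b₃`
(the orthonormal vectors complementary to `b₀` in an oriented `4`-frame),
`(∇₁W)_{23ZU} + (∇₂W)_{31ZU} + (∇₃W)_{12ZU} = 0` — the instance of the second Bianchi identity for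
`W` which, together with `sum_apply_covWeylAt_first_eq_zero_of_einstein`, is `(δW⁺)_{0ZU} = 0`
(`2δW⁺ = δW + δ(⋆W)`, `W⁺ = ½(W + ⋆W)`; Gursky–LeBrun 1999, §3, (div)).
[cite: GurskyLebrun1999, §3, (div)] [cite: Besse1987, 16.3–16.5] -/
theorem IsMetricOn.star_divergence_weylAt_eq_zero_of_einstein (b₁ b₂ b₃ Z U : E) :
    G x (covWeylAt G x b₁ b₂ b₃ Z) U + G x (covWeylAt G x b₂ b₃ b₁ Z) U +
      G x (covWeylAt G x b₃ b₁ b₂ Z) U = 0 :=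
  hG.apply_covWeylAt_cyclic_of_einstein hx hm hE b₁ b₂ b₃ Z U

end Orthonormal

end MetricCoord

end Literature.Geometry.Lorentzian

end
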